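import Summits.ValiantsHypothesis.ValiantsHypothesis.Theorems.GrenetZeonDualUnipotentThreeHalvesHeavyTopHalfSpeedSeam
import Summits.ValiantsHypothesis.ValiantsHypothesis.Theorems.GrenetZeonDualUnipotentThreeHalvesHeavyTopHalfSpeedSeamCodim

/-!
# `GrenetZeon.DualUnipotentThreeHalves` (stmt-ValiantsHypothesis-24318), LINE β `half_speed`, stub K1 — ★ THE SEAM STEP,
# packaged (profile + codimension): the induction step of `HalfSpeedIrrLaw → HalfSpeedLaw` for ONE seam

`exists_halfSpeed_seam`: for a linear space `U` of block-upper matrices over `ι₁ ⊕ ι₂` whose diagonal blocks lie in `U₁`, `U₂`,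
and certificates `T₁ ≤ U₁` at height `Θ₁`, `T₂ ≤ U₂` at height `Θ₂` (`HalfSpeed Θᵢ Uᵢ Tᵢ`), there is `T ≤ U` with
`HalfSpeed (Θ₁ + Θ₂ + 1) U T` AND `codim_U T ≤ codim_{U₁} T₁ + codim_{U₂} T₂` — ✓ `halfSpeed_of_blocks_submodule` (Seam) +
✓ `exists_seam_submodule` (SeamCodim).  Iterating this along a composition chain (✓ `HeavyTopCompositionBound.exists_block_conj`,
transports ✓ `halfSpeed_reindex` / `halfSpeed_conj`) with the card's allocation is the rest of K1 (not here).
Honest framing: the induction STEP of a stub of LINE β; nothing here proves `HalfSpeedLaw`, `HalfSpeedIrrLaw`, `HeavyTopLaw`,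
24318, S3b or 8062; `VP ≠ VNP` is not moved; no summit statement is proved here.  No definitions, no named facts. [β card K1]
-/

noncomputable section

-- single-conjunct layout: Sub = Summit, duplicated namespace component intended
set_option linter.dupNamespace false

namespace Summit.ValiantsHypothesis.ValiantsHypothesis.Theorems.GrenetZeon.HalfSpeed

open Matrix

/-- **THE SEAM STEP of K1** (profile and codimension together). [β card K1; ✓ `halfSpeed_of_blocks_submodule`,
✓ `exists_seam_submodule`] -/
theorem exists_halfSpeed_seam {ι₁ ι₂ : Type*} [Fintype ι₁] [Fintype ι₂] [DecidableEq ι₁] [DecidableEq ι₂]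
    (Θ₁ Θ₂ : ℕ) (U : Submodule ℂ (Matrix (ι₁ ⊕ ι₂) (ι₁ ⊕ ι₂) ℂ)) (hblock : ∀ A ∈ U, A.toBlocks₂₁ = 0)
    (U₁ T₁ : Submodule ℂ (Matrix ι₁ ι₁ ℂ)) (U₂ T₂ : Submodule ℂ (Matrix ι₂ ι₂ ℂ))
    (hU₁ : ∀ A ∈ U, A.toBlocks₁₁ ∈ U₁) (hU₂ : ∀ A ∈ U, A.toBlocks₂₂ ∈ U₂) (hT₁ : T₁ ≤ U₁) (hT₂ : T₂ ≤ U₂)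
    (h₁ : HalfSpeed Θ₁ (U₁ : Set (Matrix ι₁ ι₁ ℂ)) T₁) (h₂ : HalfSpeed Θ₂ (U₂ : Set (Matrix ι₂ ι₂ ℂ)) T₂) :
    ∃ T : Submodule ℂ (Matrix (ι₁ ⊕ ι₂) (ι₁ ⊕ ι₂) ℂ), T ≤ U ∧
      HalfSpeed (Θ₁ + Θ₂ + 1) (U : Set (Matrix (ι₁ ⊕ ι₂) (ι₁ ⊕ ι₂) ℂ)) T ∧
      Module.finrank ℂ U + Module.finrank ℂ T₁ + Module.finrank ℂ T₂ ≤
        Module.finrank ℂ T + Module.finrank ℂ U₁ + Module.finrank ℂ U₂ := by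
  obtain ⟨T, hTU, hmem, hdim⟩ := exists_seam_submodule U U₁ T₁ U₂ T₂ hU₁ hU₂ hT₁ hT₂
  refine ⟨T, hTU, ?_, hdim⟩
  exact halfSpeed_of_blocks_submodule Θ₁ Θ₂ U T U₁ T₁ U₂ T₂ hblock hU₁ hU₂ hTU
    (fun A hA => ((hmem A).1 hA).2.1) (fun A hA => ((hmem A).1 hA).2.2) h₁ h₂

end Summit.ValiantsHypothesis.ValiantsHypothesis.Theorems.GrenetZeon.HalfSpeed

end
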